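import Summits.QuantumFields.YangMills.Theorems.BalabanUVNodesN11ChiPrimeFineOrbitAverageBoundTransport
import Literature.MathematicalPhysics.QuantumFieldTheory.Balaban1983to89.Node00.Record12MeasurabilityAbsolute
import Literature.MathematicalPhysics.QuantumFieldTheory.Balaban1983to89.Node00.Record13CoPH

/-!
# DAG node N11 — LOCATED-FP IN NUMBERS, ON THE GRAPH OF THE AVERAGING AND AT EVERY LAWFUL `θ`: under the product Haar measure `dU` the (3.3)-ALL-SMALL CLASS
# `{U | χ′_k(X)(U, ŪU) = 1}` has measure `≤ Haar{|h − 1| < 2δ_k}^{#T}` (one block comb per block: exponent `|Y|·(L^d − 1)`); the all-small piece of the top pair has total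
# mass `≤ Haar{…}^{|Y|(L^d−1)}·∫ρ₀`; g32's a.e. transport bounds hold at every `θ` meeting `Provisos₁₃CoPH` with NO displayed row (count-neutral helper, K1⁹ `--supports 27364`)

HEADER — WORK-UNIT METADATA.  Cell `pub-ymgap`, YM-PLAN Track A (HUMAN RULING D-0062), seat `pub-ymgap-dag-n11-e` (g33; N11 [B14], s3 lineage = the averaging side of def-T's
one-step transport (†)), route `BalabanUVNodes`, item K1⁹ = stmt-QuantumFields-27364 (`--kind proof --supports 27364 --as helper`, count-neutral).  [III] = [Balaban1988Convergent],
[I] = [Balaban1987RG1].  Over this seat's g32 D `…N11ChiPrimeFineOrbitAverageBound` (★★★ `abs_integral_chiPrime_mul_fineOrbit_le`: the UNIFORM fine-gauge orbit average of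
`χ′_k(X)·w̃` is `≤ C·Haar{|h − 1| < 2δ}^{#T}` at every `(U,V)`), E `…BoundTransport` (§4 the top pair), g31 A `…N11TransportFineGaugeOrbitAverage` (★★★
`integral_fineOrbitAvg_mul_mul_comp_avg`: the pairing `∫dU f·ρ·h(Ū)` sees only `f`'s orbit average), K0c's `Node00.Record12MeasurabilityAbsolute.localBgMeasurable` ((H-U) PROVED)
and def-T's `Record12Measurability.measurableSet_smallApproxFluct_of_localBg`, RECORD 13 `Stage13HParams.Provisos₁₃CoPH` (rows `zetaMeas`, `zetaAbs`).

WHY THIS FILE.  (1) ref-I READ-554 on D (PASS): «the file does not record `Measurable`∕`Integrable` of `g ↦ χ′_k(X)(U^{u_g},V)`; the transport file should carry it» — E carries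
the joint measurability `hm` of `(U,V′) ↦ χ′_k(X)·Σ_Sζ` and the size row `hζ` as DISPLAYED hypotheses at the record; both are rows the tree supplies ((H-U) = K0c's THEOREM
`localBgMeasurable`; (H-ζ), `Σ|ζ| ≤ 1` = rows `zetaMeas` ∕ `zetaAbs` of every Stage-13 proviso edition).  §2 proves `(U,V′) ↦ χ′_k(X)(U,V′)` jointly measurable AT THE RECORD
(every `k`, `X`, `2δ`), hence E's `hm` BY NAME; §3 restates E §4 at every `θ` with `Provisos₁₃CoPH`, no row displayed.  (2) dag-n11-d g19's graph reading (INTENT-8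
`…TopPairStepWeightDeadOnGraph`: the top pair's step weight dies `dU`-a.e. ON THE GRAPH `(U, ŪU)`; «whether the all-small class is `dU`-null is NOT claimed»).  §1 moves g32's
orbit bound onto the graph: `Ū` is fine-gauge invariant, so `F(U) := f(U, ŪU)` has orbit average `∫∏dg f(U^{u_g}, ŪU)`, and A's pairing law with D's bound gives
`|∫dU χ′_k(X)(U,ŪU)·w̃(U,ŪU)·ρ(U)| ≤ C·Haar{|h − 1| < 2δ}^{#T}·∫ρ`, in particular `dU{U | χ′_k(X)(U,ŪU) = 1} ≤ Haar{|h − 1| < 2δ}^{#T}`: the (3.3)-all-small class on the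
graph — it contains dag-n11-d's all-small class (theirs also asks (3.2)-smallness at `ŪU`) — is NOT shown null, but IS exponentially small in `|Y|` under `dU`.

WHAT THIS FILE PROVES (0 `def`, 0 `sorry`, standard axioms).  §1 (generic `G`) `fineOrbit_graph_congr` · ★★ `abs_integral_graph_family_mul_le` · ★★★ `abs_integral_chiPrime_mul_graph_le`
· ★★ `integral_chiPrime_graph_le_pow` · `chiPrime_graph_eq_indicator` · ★★★ `measure_smallApproxFluct_graph_le_pow`.  §2 (record, every `k`) ★ `measurable_chiPrime_sect3DataOfRecord` ·
`measurable_sum_zeta_of_zetaMeasurable` · ★ `measurable_chiPrime_mul_sum_zeta_of_record` (E's `hm`).  §3 (top pair) ★★★ `abs_firstStep_oldSide_le_ae_of_provisos` · ★★★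
`…_blockCombs_of_provisos` · ★★★ `abs_integral_firstStep_allSmallPiece_graph_le_blockCombs` · ★★★ `measure_allSmall33_graph_le_pow_blockCombs` (`≤ Haar{|h − 1| < 2δ}^{|Y|·(L^d − 1)}`,
every `Y ⊆ T^{(1)}`) · ★★ `…_su2` (`≤ (π²(2δ)³∕12)^{|Y|·(L^d − 1)}`) · `…_of_three_side_le` (dag-n11-d's cube guard `3·LM₁ ≤ side`).

HONEST FRAMING.  [folklore] measure theory composed BY NAME with def-T's ∕ r11's ∕ K0c's typed objects; UPPER BOUNDS on quantities of def-T's typed (†) and on the product Haar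
measure of a typed event — nothing of Bałaban's ESTIMATES asserted, no identity of print asserted or refuted; the all-small class is NOT shown null (on the solvable branch the
(2.16) background is a classical-choice minimiser; no lower bound claimed); (O3′) ∕ Thm 1 ∕ Thm 2 NOT touched; N11 NOT discharged; K1⁹ NOT closed; counts unmoved (typed 28∕28 ·
discharged 6∕27 · A 6∕28); one finite-`𝕋⁴` programme at fixed `ε` — NOT `ℝ⁴`, NOT OS, NOT a mass gap, NOT Clay.  No `sorry`, `axiom`, `def`, `instance`, `notation`.  Sources (SHAPE
only): [III] (1.5)–(1.6) p.247, (3.1) p.264, (3.2)–(3.4) p.265 with L.8–12, (3.16) p.268, Thm 1 p.262; [I] (0.13)–(0.16) pp.254–255, (0.19) p.255; [Balaban1985Averaging] (10) p.19.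
-/

noncomputable section
open MeasureTheory Function
open scoped ENNReal BigOperators
namespace Summit.QuantumFields.YangMills.Theorems.BalabanUVNodesN11ChiPrimeAllSmallClassMeasure

open Literature.MathematicalPhysics.QuantumFieldTheory.Balaban1983to89
open GaugeField (gaugeAct)
open T4AxialGaugeFixing (TreeOrder combBonds)
open B12FaddeevPopov016 (FineGauge FineGaugeInvariant FPIdx fineTransf fineGauge_fineTransf)
open B14.Sect3Decomp (Sect3Data chiPrime Vbox SmallApproxFluct chiPrime_eq_one_iff)
open BalabanUVNodesN11TransportFineGaugeOrbitAverage (integral_fineOrbitAvg_mul_mul_comp_avg integrable_fineOrbitAvg_mul fineGaugeInvariant_rhoZeroOfRecord)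
open BalabanUVNodesN11ChiPrimeFineOrbitAverageBound (chiPrime_nonneg chiPrime_le_one abs_integral_chiPrime_mul_fineOrbit_le)
open BalabanUVNodesN11TransportBlockCombGauge (blockOf_ends_of_mem_blockComb exists_treeOrder_blockCombs_avoiding_emb)
open BalabanUVNodesN11BlockCombCard (card_blockCombs)
open BalabanUVNodesN11ChiPrimeFineOrbitAverageBoundTransport (toReal_haar_dist1_lt_le_su2 mem_bondsStar_sect3DataOfRecord_of_blockOf_eq abs_sum_zeta_le_one
  abs_firstStep_oldSide_le_ae abs_firstStep_oldSide_le_ae_blockCombs)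

/-! ## §1  Generic: g32's orbit bound ON THE GRAPH `(U, ŪU)` of a fine-gauge-invariant averaging -/

section Generic
variable {P : Params} {j : ℕ} {G : Type*} [GaugeGroup G] [MeasurableSpace G] [HaarData G] [RegularGaugeGroup G]

omit [MeasurableSpace G] [HaarData G] [RegularGaugeGroup G] in
/-- **ON THE GRAPH THE COARSE ARGUMENT STAYS PUT ALONG THE FINE GAUGE ORBIT** (`Ū` invariant under the fine gauge group): `f(U^{u_g}, Ū(U^{u_g})) = f(U^{u_g}, ŪU)` — so the
orbit average of `U ↦ f(U, ŪU)` at `U` is the `V := ŪU` orbit average of `f(·,V)`. [cite: Balaban1985Averaging, (10) p.19; Balaban1987RG1, (0.13) p.254] -/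
theorem fineOrbit_graph_congr (hj : j + 1 ≤ P.m + P.K) {avg : GaugeField P j G → GaugeField P (j + 1) G}
    (havgInv : ∀ u : GaugeTransf P j G, FineGauge u → ∀ U, avg (gaugeAct u U) = avg U) {β : Type*} (f : GaugeField P j G → GaugeField P (j + 1) G → β)
    (U : GaugeField P j G) :
    (fun g : FPIdx P j → G => f (gaugeAct (fineTransf g) U) (avg (gaugeAct (fineTransf g) U))) = fun g => f (gaugeAct (fineTransf g) U) (avg U) :=
  funext fun g => by rw [havgInv _ (fineGauge_fineTransf hj g) U]

/-- ★★ **AN ORBIT-AVERAGE BOUND ON A FACTOR BOUNDS ITS PAIRING ON THE GRAPH BY THE MASS OF THE DENSITY**: `Ū` measurable and invariant under the fine gauge group, `ρ ≥ 0`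
fine-gauge-invariant integrable, `f(U,V)` bounded jointly measurable with `|∫∏dg f(U^{u_g},V)| ≤ a` at every `(U,V)` ⟹ `|∫dU f(U, ŪU)·ρ(U)| ≤ a·∫dU ρ` (A's pairing law for
`F(U) := f(U, ŪU)`, whose orbit average is the `V := ŪU` one). [cite: Balaban1987RG1, (0.13)–(0.16) pp.254–255; Balaban1985Averaging, (10) p.19] -/
theorem abs_integral_graph_family_mul_le (hj : j + 1 ≤ P.m + P.K) {avg : GaugeField P j G → GaugeField P (j + 1) G}
    (havg : Measurable avg) (havgInv : ∀ u : GaugeTransf P j G, FineGauge u → ∀ U, avg (gaugeAct u U) = avg U)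
    {ρ : Density P j G} (hρ : FineGaugeInvariant ρ) (hρi : Integrable ρ (fieldMeasure P j G)) (hρ0 : ∀ U, 0 ≤ ρ U)
    {f : GaugeField P j G → GaugeField P (j + 1) G → ℝ} (hfm : Measurable fun p : GaugeField P j G × GaugeField P (j + 1) G => f p.1 p.2)
    {C : ℝ} (hfb : ∀ U V, |f U V| ≤ C) {a : ℝ}
    (hav : ∀ U V, |∫ g, f (gaugeAct (fineTransf g) U) V ∂Measure.pi (fun _ : FPIdx P j => (HaarData.haar : Measure G))| ≤ a) :
    |∫ U, f U (avg U) * ρ U ∂fieldMeasure P j G| ≤ a * ∫ U, ρ U ∂fieldMeasure P j G := by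
  set F : GaugeField P j G → ℝ := fun U => f U (avg U) with hF
  have hFm : Measurable F := hfm.comp (measurable_id.prodMk havg)
  have hFb : ∀ U, |F U| ≤ C := fun U => hfb U (avg U)
  -- A's pairing law with `h := 1`
  have key := integral_fineOrbitAvg_mul_mul_comp_avg hj havg havgInv hρ hρi hFm hFb (h := fun _ => (1 : ℝ)) measurable_const (C' := 1)
    (fun _ => by simp)
  simp only [mul_one] at key
  -- the orbit average of `F` at `U` is the `V := ŪU` orbit average of `f(·,V)`
  have horb : ∀ U : GaugeField P j G,
      ∫ g, F (gaugeAct (fineTransf g) U) ∂Measure.pi (fun _ : FPIdx P j => (HaarData.haar : Measure G)) =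
        ∫ g, f (gaugeAct (fineTransf g) U) (avg U) ∂Measure.pi (fun _ : FPIdx P j => (HaarData.haar : Measure G)) := fun U => by
    simp only [hF]; rw [fineOrbit_graph_congr hj havgInv f U]
  have hint : Integrable (fun U => (∫ g, F (gaugeAct (fineTransf g) U) ∂Measure.pi (fun _ : FPIdx P j => (HaarData.haar : Measure G))) * ρ U)
      (fieldMeasure P j G) := integrable_fineOrbitAvg_mul hρi hFm hFb
  rw [← key]
  calc |∫ U, (∫ g, F (gaugeAct (fineTransf g) U) ∂Measure.pi (fun _ : FPIdx P j => (HaarData.haar : Measure G))) * ρ U ∂fieldMeasure P j G|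
      ≤ ∫ U, |(∫ g, F (gaugeAct (fineTransf g) U) ∂Measure.pi (fun _ : FPIdx P j => (HaarData.haar : Measure G))) * ρ U| ∂fieldMeasure P j G :=
        abs_integral_le_integral_abs
    _ ≤ ∫ U, a * ρ U ∂fieldMeasure P j G :=
        integral_mono_of_nonneg (ae_of_all _ fun U => abs_nonneg _) (hρi.const_mul a) (ae_of_all _ fun U => by
          show |_ * ρ U| ≤ a * ρ U
          rw [abs_mul, abs_of_nonneg (hρ0 U), horb U]
          exact mul_le_mul_of_nonneg_right (hav U (avg U)) (hρ0 U))
    _ = a * ∫ U, ρ U ∂fieldMeasure P j G := integral_const_mul _ _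

variable [DecidableEq (PBond P j)]

/-- ★★★ **ON THE GRAPH, THE (3.3)-ALL-SMALL WEIGHT PAIRS TO AT MOST `C·Haar{|h − 1| < 2δ}^{#T}` TIMES THE MASS OF THE DENSITY**: for a weight `χ′_k(X)(U,V)·w̃(U,V)`,
`w̃` jointly measurable with `|w̃| ≤ C`, `ρ ≥ 0` fine-gauge-invariant integrable, `Ū` invariant under the fine gauge group, `T` a centre-avoiding tree read by cubes of `X`:
`|∫dU χ′_k(X)(U,ŪU)·w̃(U,ŪU)·ρ(U)| ≤ C·Haar{|h − 1| < 2δ}^{#T}·∫dU ρ` (the integrated form of E's a.e. bound under (†), read on the graph where dag-n11-d's reading lives).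
[cite: Balaban1988Convergent, (3.1) p.264, (3.3)–(3.4) p.265 with L.8–12, (3.16) p.268; Balaban1987RG1, (0.13)–(0.16) pp.254–255, (0.19) p.255] -/
theorem abs_integral_chiPrime_mul_graph_le (hj : j + 1 ≤ P.m + P.K) {avg : GaugeField P j G → GaugeField P (j + 1) G}
    (havg : Measurable avg) (havgInv : ∀ u : GaugeTransf P j G, FineGauge u → ∀ U, avg (gaugeAct u U) = avg U)
    {ρ : Density P j G} (hρ : FineGaugeInvariant ρ) (hρi : Integrable ρ (fieldMeasure P j G)) (hρ0 : ∀ U, 0 ≤ ρ U)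
    (D : Sect3Data P G j) (av : ∀ i, Averaging P i G) (twoδ : ℝ) (X : Finset D.Cube1)
    {T : Finset (PBond P j)} {v : PBond P j → Site P j} {r : Site P j → ℕ} (hT : TreeOrder T v r)
    (hv : ∀ b ∈ T, ∀ y : Site P (j + 1), v b ≠ emb y) (cT : PBond P j → D.Cube1) (hcX : ∀ b ∈ T, cT b ∈ X)
    (hcb : ∀ b ∈ T, b ∈ D.bondsStar (cT b))
    {w : GaugeField P j G → GaugeField P (j + 1) G → ℝ}
    (hm : Measurable fun p : GaugeField P j G × GaugeField P (j + 1) G => chiPrime D av twoδ X p.1 p.2 * w p.1 p.2)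
    {C : ℝ} (hw : ∀ U V, |w U V| ≤ C) :
    |∫ U, chiPrime D av twoδ X U (avg U) * w U (avg U) * ρ U ∂fieldMeasure P j G| ≤
      C * ((HaarData.haar : Measure G) {h : G | dist1 h < twoδ}).toReal ^ T.card * ∫ U, ρ U ∂fieldMeasure P j G := by
  have hC : 0 ≤ C := (abs_nonneg _).trans (hw 1 1)
  have hfb : ∀ U V, |chiPrime D av twoδ X U V * w U V| ≤ C := fun U V => by
    rw [abs_mul, abs_of_nonneg (chiPrime_nonneg D av twoδ X U V)]
    calc chiPrime D av twoδ X U V * |w U V| ≤ 1 * C :=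
          mul_le_mul (chiPrime_le_one D av twoδ X U V) (hw U V) (abs_nonneg _) zero_le_one
      _ = C := one_mul C
  exact abs_integral_graph_family_mul_le hj havg havgInv hρ hρi hρ0 hm hfb
    (fun U V => abs_integral_chiPrime_mul_fineOrbit_le D av twoδ X V hT hv cT hcX hcb (w := fun Vk => w Vk V) (fun Vk => hw Vk V) U)

omit [MeasurableSpace G] [HaarData G] [RegularGaugeGroup G] [DecidableEq (PBond P j)] in
/-- The constant density `1` is fine-gauge invariant (bookkeeping). [folklore] -/
theorem fineGaugeInvariant_one : FineGaugeInvariant (fun _ : GaugeField P j G => (1 : ℝ)) := fun _ _ _ => rfl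
/-- ★★ **`∫dU χ′_k(X)(U, ŪU) ≤ Haar{|h − 1| < 2δ}^{#T}`** (the previous bound with `ρ = w̃ = 1`; `dU` is a probability measure).
[cite: Balaban1988Convergent, (3.3)–(3.4) p.265; Balaban1987RG1, (0.13)–(0.16) pp.254–255] -/
theorem integral_chiPrime_graph_le_pow (hj : j + 1 ≤ P.m + P.K) {avg : GaugeField P j G → GaugeField P (j + 1) G}
    (havg : Measurable avg) (havgInv : ∀ u : GaugeTransf P j G, FineGauge u → ∀ U, avg (gaugeAct u U) = avg U)
    (D : Sect3Data P G j) (av : ∀ i, Averaging P i G) (twoδ : ℝ) (X : Finset D.Cube1)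
    {T : Finset (PBond P j)} {v : PBond P j → Site P j} {r : Site P j → ℕ} (hT : TreeOrder T v r)
    (hv : ∀ b ∈ T, ∀ y : Site P (j + 1), v b ≠ emb y) (cT : PBond P j → D.Cube1) (hcX : ∀ b ∈ T, cT b ∈ X)
    (hcb : ∀ b ∈ T, b ∈ D.bondsStar (cT b))
    (hm : Measurable fun p : GaugeField P j G × GaugeField P (j + 1) G => chiPrime D av twoδ X p.1 p.2) :
    ∫ U, chiPrime D av twoδ X U (avg U) ∂fieldMeasure P j G ≤ ((HaarData.haar : Measure G) {h : G | dist1 h < twoδ}).toReal ^ T.card := by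
  have h := abs_integral_chiPrime_mul_graph_le hj havg havgInv fineGaugeInvariant_one (integrable_const (1 : ℝ)) (fun _ => zero_le_one)
    D av twoδ X hT hv cT hcX hcb (w := fun _ _ => (1 : ℝ)) (by simpa using hm) (C := 1) (fun _ _ => by simp)
  simp only [mul_one, one_mul, integral_const, probReal_univ, smul_eq_mul] at h
  exact (le_abs_self _).trans h

omit [MeasurableSpace G] [HaarData G] [RegularGaugeGroup G] [DecidableEq (PBond P j)] in
/-- `χ′_k(X)(U, ŪU)` IS the indicator of the (3.3)-all-small class on the graph, `{U | every cube of X is (3.3)-small at (U, ŪU)}` (it is a `0∕1` function).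
[cite: Balaban1988Convergent, (3.3) p.265 (bookkeeping)] -/
theorem chiPrime_graph_eq_indicator (avg : GaugeField P j G → GaugeField P (j + 1) G) (D : Sect3Data P G j) (av : ∀ i, Averaging P i G) (twoδ : ℝ)
    (X : Finset D.Cube1) (U : GaugeField P j G) :
    chiPrime D av twoδ X U (avg U) = {U : GaugeField P j G | ∀ c ∈ X, SmallApproxFluct D av twoδ U (avg U) c}.indicator 1 U := by
  classical
  by_cases hall : ∀ c ∈ X, SmallApproxFluct D av twoδ U (avg U) c
  · have hU : U ∈ {W : GaugeField P j G | ∀ c ∈ X, SmallApproxFluct D av twoδ W (avg W) c} := hall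
    rw [Set.indicator_of_mem hU, (chiPrime_eq_one_iff D av twoδ X U (avg U)).2 hall]
    rfl
  · have hU : U ∉ {W : GaugeField P j G | ∀ c ∈ X, SmallApproxFluct D av twoδ W (avg W) c} := hall
    rw [Set.indicator_of_notMem hU]
    have h := hall
    push Not at h
    obtain ⟨c, hc, hnc⟩ := h
    unfold chiPrime
    exact Finset.prod_eq_zero hc (if_neg hnc)

/-- ★★★ **THE (3.3)-ALL-SMALL CLASS ON THE GRAPH HAS PRODUCT-HAAR MEASURE AT MOST `Haar{|h − 1| < 2δ}^{#T}`** (any (3.3)∕(3.4) datum, `Ū` invariant under the fine gauge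
group, `T` a centre-avoiding tree read by cubes of `X`): `dU{U | ∀ □′ ∈ X, sup_{b ∈ (□′^{∼2})^{(k)*}} |U(b)·V^{(k)}_{□′}(ŪU)(b)⁻¹ − 1| < 2δ} ≤ Haar{|h − 1| < 2δ}^{#T}` — under
`dU` the configurations (†) labels all-small are exponentially rare in `#T`; NO lower bound is claimed. [cite: Balaban1988Convergent, (3.3)–(3.4) p.265; Balaban1987RG1, (0.13)–(0.16) pp.254–255] -/
theorem measure_smallApproxFluct_graph_le_pow (hj : j + 1 ≤ P.m + P.K) {avg : GaugeField P j G → GaugeField P (j + 1) G}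
    (havg : Measurable avg) (havgInv : ∀ u : GaugeTransf P j G, FineGauge u → ∀ U, avg (gaugeAct u U) = avg U)
    (D : Sect3Data P G j) (av : ∀ i, Averaging P i G) (twoδ : ℝ) (X : Finset D.Cube1)
    {T : Finset (PBond P j)} {v : PBond P j → Site P j} {r : Site P j → ℕ} (hT : TreeOrder T v r)
    (hv : ∀ b ∈ T, ∀ y : Site P (j + 1), v b ≠ emb y) (cT : PBond P j → D.Cube1) (hcX : ∀ b ∈ T, cT b ∈ X)
    (hcb : ∀ b ∈ T, b ∈ D.bondsStar (cT b))
    (hm : Measurable fun p : GaugeField P j G × GaugeField P (j + 1) G => chiPrime D av twoδ X p.1 p.2) :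
    fieldMeasure P j G {U : GaugeField P j G | ∀ c ∈ X, SmallApproxFluct D av twoδ U (avg U) c} ≤
      ((HaarData.haar : Measure G) {h : G | dist1 h < twoδ}) ^ T.card := by
  set S : Set (GaugeField P j G) := {U | ∀ c ∈ X, SmallApproxFluct D av twoδ U (avg U) c} with hS
  have hgm : Measurable fun U : GaugeField P j G => chiPrime D av twoδ X U (avg U) := hm.comp (measurable_id.prodMk havg)
  have hSm : MeasurableSet S := by
    have e : S = (fun U : GaugeField P j G => chiPrime D av twoδ X U (avg U)) ⁻¹' {1} :=
      Set.ext fun U => by simpa only [hS, Set.mem_setOf_eq, Set.mem_preimage, Set.mem_singleton_iff] using (chiPrime_eq_one_iff D av twoδ X U (avg U)).symm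
    exact e ▸ hgm (measurableSet_singleton 1)
  have hint : ∫ U, chiPrime D av twoδ X U (avg U) ∂fieldMeasure P j G = (fieldMeasure P j G).real S := by
    rw [← integral_indicator_one hSm]
    exact integral_congr_ae (ae_of_all _ fun U => chiPrime_graph_eq_indicator avg D av twoδ X U)
  have hreal : (fieldMeasure P j G).real S ≤ ((HaarData.haar : Measure G) {h : G | dist1 h < twoδ}).toReal ^ T.card :=
    hint ▸ integral_chiPrime_graph_le_pow hj havg havgInv D av twoδ X hT hv cT hcX hcb hm
  calc fieldMeasure P j G S = ENNReal.ofReal ((fieldMeasure P j G).real S) := (ofReal_measureReal (measure_ne_top _ _)).symm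
    _ ≤ ENNReal.ofReal (((HaarData.haar : Measure G) {h : G | dist1 h < twoδ}).toReal ^ T.card) := ENNReal.ofReal_le_ofReal hreal
    _ = ((HaarData.haar : Measure G) {h : G | dist1 h < twoδ}) ^ T.card := by
        rw [ENNReal.ofReal_pow ENNReal.toReal_nonneg, ENNReal.ofReal_toReal (measure_ne_top _ _)]

end Generic

/-! ## §2  At the record: (3.3)'s `χ′_k(X)` is JOINTLY MEASURABLE in `(U, V′)` — (H-U) is K0c's `localBgMeasurable`; with row (H-ζ), E's `hm` BY NAME -/

section RecordMeas
open T4Continuum Node00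
variable (F : T4Family) (N : ℕ) [NeZero N] {ν : Stage7Numerics} {M : ℕ}

/-- ★ **(3.3)'s SMALL-FIELD FACTOR OF RECORD IS JOINTLY MEASURABLE IN `(U, V′)`** (every `k`, `X`, `2δ`): `sect3DataOfRecord` reads `V′` through def-R's (2.16) background
`ukBox bgOfRecord …`, measurable by K0c's `localBgMeasurable` ((H-U) PROVED), so each event `{(U,V′) | □′ (3.3)-small}` is measurable (`measurableSet_smallApproxFluct_of_localBg`,
transposed) and `χ′_k(X)` is a finite product of indicators — the row ref-I READ-554 asked for. [cite: Balaban1988Convergent, (3.3)–(3.4) p.265, (2.16) p.257 (bookkeeping)] -/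
theorem measurable_chiPrime_sect3DataOfRecord (p : B12.RunParams) (g : ℕ → ℝ) (k : ℕ) (s : SeqOfRecord F ν M g p.K k) (twoδ : ℝ)
    (X : Finset (Iχ F ν p g k)) :
    Measurable fun q : GaugeField (F.P p.K) k (SU N) × GaugeField (F.P p.K) (k + 1) (SU N) =>
      chiPrime (sect3DataOfRecord F N ν M p g k s) (avOfRecord F N p.K) twoδ X q.1 q.2 := by
  classical
  have hU : LocalBgMeasurable F N ν := localBgMeasurable F N ν
  have hS : ∀ c : Iχ F ν p g k, MeasurableSet {q : GaugeField (F.P p.K) k (SU N) × GaugeField (F.P p.K) (k + 1) (SU N) |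
      SmallApproxFluct (sect3DataOfRecord F N ν M p g k s) (avOfRecord F N p.K) twoδ q.1 q.2 c} :=
    fun c => by
    have e : {q : GaugeField (F.P p.K) k (SU N) × GaugeField (F.P p.K) (k + 1) (SU N) |
        SmallApproxFluct (sect3DataOfRecord F N ν M p g k s) (avOfRecord F N p.K) twoδ q.1 q.2 c} =
        Prod.swap ⁻¹' {z : GaugeField (F.P p.K) (k + 1) (SU N) × GaugeField (F.P p.K) k (SU N) |
          SmallApproxFluct (sect3DataOfRecord F N ν M p g k s) (avOfRecord F N p.K) twoδ z.2 z.1 c} := rfl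
    rw [e]; exact (measurableSet_smallApproxFluct_of_localBg hU M p g k s twoδ c).preimage measurable_swap
  have e : (fun q : GaugeField (F.P p.K) k (SU N) × GaugeField (F.P p.K) (k + 1) (SU N) =>
      chiPrime (sect3DataOfRecord F N ν M p g k s) (avOfRecord F N p.K) twoδ X q.1 q.2) =
      fun q => ∏ c ∈ X, if SmallApproxFluct (sect3DataOfRecord F N ν M p g k s) (avOfRecord F N p.K) twoδ q.1 q.2 c then (1 : ℝ) else 0 :=
    funext fun q => by unfold chiPrime; exact Finset.prod_congr rfl fun c _ => by congr
  rw [e]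
  exact Finset.measurable_prod _ fun c _ => Measurable.ite (hS c) measurable_const measurable_const

omit [NeZero N] in
/-- Under row (H-ζ) (`ZetaMeasurable`, the field `zetaMeas` of every Stage-13 proviso edition) the partial residual sum `Σ_S ζ(P,Q,(R,S))(U,V′)` is jointly measurable in `(U, V′)`.
[cite: Balaban1988Convergent, (3.16) p.268, (3.21) p.269 (bookkeeping)] -/
theorem measurable_sum_zeta_of_zetaMeasurable {ζ : ZetaOfRecord F N ν M} (hζ : ZetaMeasurable F N ζ) (p : B12.RunParams) (g : ℕ → ℝ) (k : ℕ)
    (s : SeqOfRecord F ν M g p.K k) (Pl Ql Rl : Finset (Iχ F ν p g k)) :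
    Measurable fun q : GaugeField (F.P p.K) k (SU N) × GaugeField (F.P p.K) (k + 1) (SU N) =>
      ∑ S : Finset (Iχ F ν p g k), ζ p g k s Pl Ql (Rl, S) q.1 q.2 :=
  Finset.measurable_sum _ fun S _ => (hζ p g k s Pl Ql (Rl, S)).comp measurable_swap

/-- ★ **E's ROW `hm` AT THE RECORD, BY NAME**: `(U,V′) ↦ χ′_k(X)(U,V′)·Σ_S ζ(P,Q,(R,S))(U,V′)` is jointly measurable, from (H-U) PROVED and (H-ζ) (row `zetaMeas`).
[cite: Balaban1988Convergent, (3.3)–(3.4) p.265, (3.16) p.268 (bookkeeping)] -/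
theorem measurable_chiPrime_mul_sum_zeta_of_record {ζ : ZetaOfRecord F N ν M} (hζ : ZetaMeasurable F N ζ) (p : B12.RunParams) (g : ℕ → ℝ) (k : ℕ)
    (s : SeqOfRecord F ν M g p.K k) (twoδ : ℝ) (X Pl Ql Rl : Finset (Iχ F ν p g k)) :
    Measurable fun q : GaugeField (F.P p.K) k (SU N) × GaugeField (F.P p.K) (k + 1) (SU N) =>
      chiPrime (sect3DataOfRecord F N ν M p g k s) (avOfRecord F N p.K) twoδ X q.1 q.2 * ∑ S : Finset (Iχ F ν p g k), ζ p g k s Pl Ql (Rl, S) q.1 q.2 :=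
  (measurable_chiPrime_sect3DataOfRecord F N p g k s twoδ X).mul (measurable_sum_zeta_of_zetaMeasurable F N hζ p g k s Pl Ql Rl)

end RecordMeas

/-! ## §3  THE TOP PAIR `(Ω₁, Λ₁) = (𝕋, 𝕋)` OF THE STAGE-13 RECORD AT EVERY LAWFUL `θ`: E §4 without displayed rows, and the graph editions -/

section TopPair
open T4Continuum Node00
open Summit.QuantumFields.YangMills.BalabanUVNodes.N13DensityOfRecordIsAveragedGibbsMeasureAtRecord13SepCoPH (integrable_rhoZeroOfRecord)
open B15Claim189CubePin (cubeOfSite cubeOfSite_mem_cubeIndices)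
open B14.Eq213MaximalDomains (side)

variable {F : T4Family} {N : ℕ} [NeZero N]
/-- The standing range `0 + 1 ≤ m + K` of the `K`-th torus from `0 < K` (bookkeeping). [folklore] -/
private theorem one_le_m_add_K {K : ℕ} (hK : 0 < K) : 0 + 1 ≤ (F.P K).m + (F.P K).K := by
  simp only [T4Family.P_K, T4Family.P_m]; omega

/-- dag-n11-d's cube guard `3·(L·M₁) ≤ side`, `1 ≤ M₁` gives E's side conditions `0 < side`, `L ≤ 2·side`. [cite: Balaban1988Convergent, (3.2) p.265 (bookkeeping)] -/
theorem sideχ_guards_of_three_side_le {ν : Stage7Numerics} (p : B12.RunParams) (g : ℕ → ℝ) (hM1 : 1 ≤ ν.M₁)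
    (h3 : 3 * side (F.P p.K).L ν.M₁ 1 ≤ sideχ F ν p g 0) : 0 < sideχ F ν p g 0 ∧ (F.P p.K).L ≤ 2 * sideχ F ν p g 0 := by
  have hs : (F.P p.K).L ≤ side (F.P p.K).L ν.M₁ 1 := by
    simpa only [side, Nat.pow_one, Nat.mul_one] using Nat.mul_le_mul_left (F.P p.K).L hM1
  have hL : 1 ≤ (F.P p.K).L := (F.P p.K).L_pos; constructor <;> omega

/-- ★★★ **E §4 AT EVERY LAWFUL `θ`, NO DISPLAYED ROW**: for every `θ : Stage13HParams F N` with `Provisos₁₃CoPH` (rows `zetaMeas`, `zetaAbs`), every run with `0 < K`, every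
length-1 history `s′`, ANY centre-avoiding tree `T` of `T^{(0)}` read by the (3.3) cubes of record: `|∫dU δ(ŪV′⁻¹)[χ′_0(ALL)·Σ_Sζ_1(∅,∅,(∅,S))·ρ₀](V′)| ≤
Haar{|h − 1| < 2δ₀}^{#T} · ∫dU δ(ŪV′⁻¹)[ρ₀](V′)` for `dV′`-a.e. `V′` (E's `abs_firstStep_oldSide_le_ae` with `hζ := zetaAbs`, `hm :=` §2).
[cite: Balaban1988Convergent, (3.1) p.264, (3.3)–(3.4) p.265 with L.8–12, (3.16) p.268, Thm 1 p.262; Balaban1987RG1, (0.13)–(0.16) pp.254–255, (0.19) p.255] -/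
theorem abs_firstStep_oldSide_le_ae_of_provisos (θ : Stage13HParams F N) (hP : θ.Provisos₁₃CoPH F N) (p : B12.RunParams) (hK : 0 < p.K)
    [DecidableEq (PBond (F.P p.K) 0)] (s' : SeqOfRecord F θ.ν θ.τ9.M (gOfRecord₁₃ F N θ.toStage13Params p) p.K 1)
    {T : Finset (PBond (F.P p.K) 0)} {v : PBond (F.P p.K) 0 → Site (F.P p.K) 0} {r : Site (F.P p.K) 0 → ℕ} (hT : TreeOrder T v r)
    (hv : ∀ b ∈ T, ∀ y : Site (F.P p.K) 1, v b ≠ emb y)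
    (cT : PBond (F.P p.K) 0 → Iχ F θ.ν p (gOfRecord₁₃ F N θ.toStage13Params p) 0)
    (hcb : ∀ b ∈ T, b ∈ (sect3DataOfRecord F N θ.ν θ.τ9.M p (gOfRecord₁₃ F N θ.toStage13Params p) 0 s'.init).bondsStar (cT b)) :
    ∀ᵐ V' ∂fieldMeasure (F.P p.K) 1 (SU N),
      |transportOfRecord F N p.K 0 (fun U =>
          chiPrime (sect3DataOfRecord F N θ.ν θ.τ9.M p (gOfRecord₁₃ F N θ.toStage13Params p) 0 s'.init) (avOfRecord F N p.K)
              (2 * deltaOfRecord θ.ν (gOfRecord₁₃ F N θ.toStage13Params p) 0 θ.A₁) (Finset.univ : Finset (Iχ F θ.ν p (gOfRecord₁₃ F N θ.toStage13Params p) 0)) U V' *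
            (∑ S : Finset (Iχ F θ.ν p (gOfRecord₁₃ F N θ.toStage13Params p) 0), θ.ζ p (gOfRecord₁₃ F N θ.toStage13Params p) 0 s'.init ∅ ∅ (∅, S) U V') *
            rhoZeroOfRecord F N p.K (gOfRecord₁₃ F N θ.toStage13Params p 0) (EOfRecord₁₃ F N θ.toStage13Params p) U) V'| ≤
        ((HaarData.haar : Measure (SU N)) {h : SU N | dist1 h < 2 * deltaOfRecord θ.ν (gOfRecord₁₃ F N θ.toStage13Params p) 0 θ.A₁}).toReal ^ T.card *
          transportOfRecord F N p.K 0 (rhoZeroOfRecord F N p.K (gOfRecord₁₃ F N θ.toStage13Params p 0) (EOfRecord₁₃ F N θ.toStage13Params p)) V' :=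
  abs_firstStep_oldSide_le_ae θ p hK s' hP.zetaAbs
    (measurable_chiPrime_mul_sum_zeta_of_record F N hP.zetaMeas p _ 0 s'.init _ Finset.univ ∅ ∅ ∅) hT hv cT hcb

/-- ★★★ **E §4's BLOCK-COMB FOREST EDITION AT EVERY LAWFUL `θ`: `|old side(V′)| ≤ Haar{|h − 1| < 2δ₀}^{|Y|·(L^d − 1)} · transportOfRecord 0 ρ₀ V′` FOR A.E. `V′`, EVERY
`Y ⊆ T^{(1)}`** (numeric side conditions `0 < side`, `L ≤ 2·side` on the `L²M₂R₁`-cubes displayed; no measurability or size row). [cite: Balaban1988Convergent, (3.1) p.264,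
(3.3)–(3.4) p.265 with L.8–12, Thm 1 p.262; Balaban1987RG1, (0.13)–(0.16) pp.254–255, (0.19) p.255] -/
theorem abs_firstStep_oldSide_le_ae_blockCombs_of_provisos (θ : Stage13HParams F N) (hP : θ.Provisos₁₃CoPH F N) (p : B12.RunParams) (hK : 0 < p.K)
    [DecidableEq (PBond (F.P p.K) 0)] (s' : SeqOfRecord F θ.ν θ.τ9.M (gOfRecord₁₃ F N θ.toStage13Params p) p.K 1)
    (hside : 0 < sideχ F θ.ν p (gOfRecord₁₃ F N θ.toStage13Params p) 0) (hL : (F.P p.K).L ≤ 2 * sideχ F θ.ν p (gOfRecord₁₃ F N θ.toStage13Params p) 0)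
    (Y : Finset (Site (F.P p.K) 1)) :
    ∀ᵐ V' ∂fieldMeasure (F.P p.K) 1 (SU N),
      |transportOfRecord F N p.K 0 (fun U =>
          chiPrime (sect3DataOfRecord F N θ.ν θ.τ9.M p (gOfRecord₁₃ F N θ.toStage13Params p) 0 s'.init) (avOfRecord F N p.K)
              (2 * deltaOfRecord θ.ν (gOfRecord₁₃ F N θ.toStage13Params p) 0 θ.A₁) (Finset.univ : Finset (Iχ F θ.ν p (gOfRecord₁₃ F N θ.toStage13Params p) 0)) U V' *
            (∑ S : Finset (Iχ F θ.ν p (gOfRecord₁₃ F N θ.toStage13Params p) 0), θ.ζ p (gOfRecord₁₃ F N θ.toStage13Params p) 0 s'.init ∅ ∅ (∅, S) U V') *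
            rhoZeroOfRecord F N p.K (gOfRecord₁₃ F N θ.toStage13Params p 0) (EOfRecord₁₃ F N θ.toStage13Params p) U) V'| ≤
        ((HaarData.haar : Measure (SU N)) {h : SU N | dist1 h < 2 * deltaOfRecord θ.ν (gOfRecord₁₃ F N θ.toStage13Params p) 0 θ.A₁}).toReal ^
            (Y.card * ((F.P p.K).L ^ (F.P p.K).d - 1)) *
          transportOfRecord F N p.K 0 (rhoZeroOfRecord F N p.K (gOfRecord₁₃ F N θ.toStage13Params p 0) (EOfRecord₁₃ F N θ.toStage13Params p)) V' :=
  abs_firstStep_oldSide_le_ae_blockCombs θ p hK s' hP.zetaAbs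
    (measurable_chiPrime_mul_sum_zeta_of_record F N hP.zetaMeas p _ 0 s'.init _ Finset.univ ∅ ∅ ∅) hside hL Y

/-- ★★★ **THE TOTAL MASS OF THE TOP PAIR's ALL-SMALL PIECE ON THE GRAPH IS VOLUME-SUPPRESSED**: at every `θ` with `Provisos₁₃CoPH`, `0 < K`, every length-1 `s′`, every
`Y ⊆ T^{(1)}` (cube side conditions displayed): `|∫dU χ′_0(ALL)(U,ŪU)·Σ_Sζ_1(∅,∅,(∅,S))(U,ŪU)·ρ₀(U)| ≤ Haar{|h − 1| < 2δ₀}^{|Y|·(L^d − 1)} · ∫dU ρ₀` — the integrand of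
dag-n11-d's graph reading, summed against `ρ₀ = e^{−E}e^{−A∕g₀²}`, is exponentially small in `|Y|`; in print this is the LEADING term, read after (1.5)⇒(1.6).
[cite: Balaban1988Convergent, (3.1) p.264, (3.3)–(3.4) p.265 with L.8–12, (3.16) p.268, Thm 1 p.262; Balaban1987RG1, (0.13)–(0.16) pp.254–255, (0.19) p.255] -/
theorem abs_integral_firstStep_allSmallPiece_graph_le_blockCombs (θ : Stage13HParams F N) (hP : θ.Provisos₁₃CoPH F N) (p : B12.RunParams) (hK : 0 < p.K)
    [DecidableEq (PBond (F.P p.K) 0)] (s' : SeqOfRecord F θ.ν θ.τ9.M (gOfRecord₁₃ F N θ.toStage13Params p) p.K 1)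
    (hside : 0 < sideχ F θ.ν p (gOfRecord₁₃ F N θ.toStage13Params p) 0) (hL : (F.P p.K).L ≤ 2 * sideχ F θ.ν p (gOfRecord₁₃ F N θ.toStage13Params p) 0)
    (Y : Finset (Site (F.P p.K) 1)) :
    |∫ U, chiPrime (sect3DataOfRecord F N θ.ν θ.τ9.M p (gOfRecord₁₃ F N θ.toStage13Params p) 0 s'.init) (avOfRecord F N p.K)
          (2 * deltaOfRecord θ.ν (gOfRecord₁₃ F N θ.toStage13Params p) 0 θ.A₁) (Finset.univ : Finset (Iχ F θ.ν p (gOfRecord₁₃ F N θ.toStage13Params p) 0))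
          U ((avOfRecord F N p.K 0).avg U) *
        (∑ S : Finset (Iχ F θ.ν p (gOfRecord₁₃ F N θ.toStage13Params p) 0),
          θ.ζ p (gOfRecord₁₃ F N θ.toStage13Params p) 0 s'.init ∅ ∅ (∅, S) U ((avOfRecord F N p.K 0).avg U)) *
        rhoZeroOfRecord F N p.K (gOfRecord₁₃ F N θ.toStage13Params p 0) (EOfRecord₁₃ F N θ.toStage13Params p) U ∂fieldMeasure (F.P p.K) 0 (SU N)| ≤
      ((HaarData.haar : Measure (SU N)) {h : SU N | dist1 h < 2 * deltaOfRecord θ.ν (gOfRecord₁₃ F N θ.toStage13Params p) 0 θ.A₁}).toReal ^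
          (Y.card * ((F.P p.K).L ^ (F.P p.K).d - 1)) *
        ∫ U, rhoZeroOfRecord F N p.K (gOfRecord₁₃ F N θ.toStage13Params p 0) (EOfRecord₁₃ F N θ.toStage13Params p) U ∂fieldMeasure (F.P p.K) 0 (SU N) := by
  have hj : 0 + 1 ≤ (F.P p.K).m + (F.P p.K).K := one_le_m_add_K hK
  obtain ⟨v, r, hT, hv⟩ := exists_treeOrder_blockCombs_avoiding_emb hj Y
  rw [← card_blockCombs (P := F.P p.K) (j := 0) hj Y]
  have h := abs_integral_chiPrime_mul_graph_le hj (avOfRecord_measurable F N p.K 0) (fun _ hu U => avOfRecord_gaugeAct_of_fineGauge F N hK hu U)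
    (fineGaugeInvariant_rhoZeroOfRecord F N p.K (gOfRecord₁₃ F N θ.toStage13Params p 0) (EOfRecord₁₃ F N θ.toStage13Params p))
    (integrable_rhoZeroOfRecord F N p.K (gOfRecord₁₃ F N θ.toStage13Params p 0) (EOfRecord₁₃ F N θ.toStage13Params p))
    (fun U => (rhoZeroOfRecord_pos F N p.K (gOfRecord₁₃ F N θ.toStage13Params p 0) (EOfRecord₁₃ F N θ.toStage13Params p) U).le)
    (sect3DataOfRecord F N θ.ν θ.τ9.M p (gOfRecord₁₃ F N θ.toStage13Params p) 0 s'.init) (avOfRecord F N p.K)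
    (2 * deltaOfRecord θ.ν (gOfRecord₁₃ F N θ.toStage13Params p) 0 θ.A₁) Finset.univ hT hv
    (fun b => ⟨cubeOfSite (sideχ F θ.ν p (gOfRecord₁₃ F N θ.toStage13Params p) 0) (emb (blockOf b.src)), cubeOfSite_mem_cubeIndices _ hside _⟩)
    (fun _ _ => Finset.mem_univ _) (fun b hb => ?_)
    (w := fun U V' => ∑ S : Finset (Iχ F θ.ν p (gOfRecord₁₃ F N θ.toStage13Params p) 0), θ.ζ p (gOfRecord₁₃ F N θ.toStage13Params p) 0 s'.init ∅ ∅ (∅, S) U V')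
    (measurable_chiPrime_mul_sum_zeta_of_record F N hP.zetaMeas p _ 0 s'.init _ Finset.univ ∅ ∅ ∅) (C := 1)
    (fun U V' => abs_sum_zeta_le_one hP.zetaAbs p _ 0 s'.init ∅ ∅ ∅ U V')
  · rwa [one_mul] at h
  · obtain ⟨y, -, hby⟩ := Finset.mem_biUnion.1 hb
    obtain ⟨hsrc, htgt⟩ := blockOf_ends_of_mem_blockComb hj y hby
    exact mem_bondsStar_sect3DataOfRecord_of_blockOf_eq (N := N) p hK _ s'.init hside hL rfl (htgt.trans hsrc.symm)

/-- ★★★ **THE (3.3)-ALL-SMALL CLASS OF RECORD ON THE GRAPH HAS `dU`-MEASURE AT MOST `Haar{|h − 1| < 2δ}^{|Y|·(L^d − 1)}`, EVERY `Y ⊆ T^{(1)}`** (step `k+1 = 1`, `0 < K`,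
any length-0 history `s`, any `2δ`, the averaging of record; cube side conditions displayed).  dag-n11-d's all-small class (also (3.2)-small at `ŪU`) is contained in this set;
neither is shown null (solvable branch: the (2.16) background is a classical-choice minimiser, no lower bound available), but under `dU` both are exponentially small in `|Y|`.
[cite: Balaban1988Convergent, (3.2)–(3.4) p.265 with L.8–12, (2.16) p.257; Balaban1987RG1, (0.13)–(0.16) pp.254–255] -/
theorem measure_allSmall33_graph_le_pow_blockCombs {ν : Stage7Numerics} {M : ℕ} (p : B12.RunParams) (hK : 0 < p.K) [DecidableEq (PBond (F.P p.K) 0)] (g : ℕ → ℝ)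
    (s : SeqOfRecord F ν M g p.K 0) (twoδ : ℝ) (hside : 0 < sideχ F ν p g 0) (hL : (F.P p.K).L ≤ 2 * sideχ F ν p g 0) (Y : Finset (Site (F.P p.K) 1)) :
    fieldMeasure (F.P p.K) 0 (SU N) {U : GaugeField (F.P p.K) 0 (SU N) |
        ∀ c : Iχ F ν p g 0, SmallApproxFluct (sect3DataOfRecord F N ν M p g 0 s) (avOfRecord F N p.K) twoδ U ((avOfRecord F N p.K 0).avg U) c} ≤
      ((HaarData.haar : Measure (SU N)) {h : SU N | dist1 h < twoδ}) ^ (Y.card * ((F.P p.K).L ^ (F.P p.K).d - 1)) := by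
  have hj : 0 + 1 ≤ (F.P p.K).m + (F.P p.K).K := one_le_m_add_K hK
  obtain ⟨v, r, hT, hv⟩ := exists_treeOrder_blockCombs_avoiding_emb hj Y
  rw [← card_blockCombs (P := F.P p.K) (j := 0) hj Y]
  have e : {U : GaugeField (F.P p.K) 0 (SU N) |
      ∀ c : Iχ F ν p g 0, SmallApproxFluct (sect3DataOfRecord F N ν M p g 0 s) (avOfRecord F N p.K) twoδ U ((avOfRecord F N p.K 0).avg U) c} =
      {U | ∀ c ∈ (Finset.univ : Finset (Iχ F ν p g 0)),
        SmallApproxFluct (sect3DataOfRecord F N ν M p g 0 s) (avOfRecord F N p.K) twoδ U ((avOfRecord F N p.K 0).avg U) c} := by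
    ext U; simp only [Set.mem_setOf_eq, Finset.mem_univ, forall_true_left]
  rw [e]
  refine measure_smallApproxFluct_graph_le_pow hj (avOfRecord_measurable F N p.K 0) (fun _ hu U => avOfRecord_gaugeAct_of_fineGauge F N hK hu U)
    (sect3DataOfRecord F N ν M p g 0 s) (avOfRecord F N p.K) twoδ Finset.univ hT hv
    (fun b => ⟨cubeOfSite (sideχ F ν p g 0) (emb (blockOf b.src)), cubeOfSite_mem_cubeIndices _ hside _⟩) (fun _ _ => Finset.mem_univ _) (fun b hb => ?_)
    (measurable_chiPrime_sect3DataOfRecord F N p g 0 s twoδ Finset.univ)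
  obtain ⟨y, -, hby⟩ := Finset.mem_biUnion.1 hb
  obtain ⟨hsrc, htgt⟩ := blockOf_ends_of_mem_blockComb hj y hby
  exact mem_bondsStar_sect3DataOfRecord_of_blockOf_eq (N := N) p hK _ s hside hL rfl (htgt.trans hsrc.symm)

/-- ★★ **AT `N = 2`: THE (3.3)-ALL-SMALL CLASS OF RECORD ON THE GRAPH HAS `dU`-MEASURE AT MOST `(π²(2δ)³∕12)^{|Y|·(L^d − 1)}`** (`0 ≤ 2δ ≤ 1`; dag-n08-w3's SU(2) ball volume
BY NAME) — e.g. exponent `15·|Y|` at `L = 2`, `d = 4`. [cite: Balaban1988Convergent, (3.3)–(3.4) p.265; Balaban1985UV3, p.260 (bookkeeping)] -/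
theorem measure_allSmall33_graph_le_pow_blockCombs_su2 {F : T4Family} {ν : Stage7Numerics} {M : ℕ} (p : B12.RunParams) (hK : 0 < p.K)
    [DecidableEq (PBond (F.P p.K) 0)] (g : ℕ → ℝ) (s : SeqOfRecord F ν M g p.K 0) {twoδ : ℝ} (h0 : 0 ≤ twoδ) (h1 : twoδ ≤ 1)
    (hside : 0 < sideχ F ν p g 0) (hL : (F.P p.K).L ≤ 2 * sideχ F ν p g 0) (Y : Finset (Site (F.P p.K) 1)) :
    fieldMeasure (F.P p.K) 0 (SU 2) {U : GaugeField (F.P p.K) 0 (SU 2) |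
        ∀ c : Iχ F ν p g 0, SmallApproxFluct (sect3DataOfRecord F 2 ν M p g 0 s) (avOfRecord F 2 p.K) twoδ U ((avOfRecord F 2 p.K 0).avg U) c} ≤
      ENNReal.ofReal ((Real.pi ^ 2 * twoδ ^ 3 / 12) ^ (Y.card * ((F.P p.K).L ^ (F.P p.K).d - 1))) := by
  refine (measure_allSmall33_graph_le_pow_blockCombs (N := 2) p hK g s twoδ hside hL Y).trans ?_
  have hfin : (HaarData.haar : Measure (SU 2)) {h : SU 2 | dist1 h < twoδ} ≠ ∞ := measure_ne_top _ _
  rw [← ENNReal.ofReal_toReal hfin, ← ENNReal.ofReal_pow ENNReal.toReal_nonneg]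
  exact ENNReal.ofReal_le_ofReal (pow_le_pow_left₀ ENNReal.toReal_nonneg (toReal_haar_dist1_lt_le_su2 h0 h1) _)

/-- ★★ **GUARD EDITION**: under dag-n11-d's cube guard `3·(L·M₁) ≤ side` with `1 ≤ M₁` (the shape of `…TopPairDescendantsDead`'s `h3`, `hM1`), the (3.3)-all-small class of record
on the graph has `dU`-measure at most `Haar{|h − 1| < 2δ}^{|Y|·(L^d − 1)}` for every `Y ⊆ T^{(1)}`. [cite: Balaban1988Convergent, (3.2)–(3.4) p.265, (2.13) p.256 (bookkeeping)] -/
theorem measure_allSmall33_graph_le_pow_blockCombs_of_three_side_le {ν : Stage7Numerics} {M : ℕ} (p : B12.RunParams) (hK : 0 < p.K)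
    [DecidableEq (PBond (F.P p.K) 0)] (g : ℕ → ℝ) (s : SeqOfRecord F ν M g p.K 0) (twoδ : ℝ) (hM1 : 1 ≤ ν.M₁)
    (h3 : 3 * side (F.P p.K).L ν.M₁ 1 ≤ sideχ F ν p g 0) (Y : Finset (Site (F.P p.K) 1)) :
    fieldMeasure (F.P p.K) 0 (SU N) {U : GaugeField (F.P p.K) 0 (SU N) |
        ∀ c : Iχ F ν p g 0, SmallApproxFluct (sect3DataOfRecord F N ν M p g 0 s) (avOfRecord F N p.K) twoδ U ((avOfRecord F N p.K 0).avg U) c} ≤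
      ((HaarData.haar : Measure (SU N)) {h : SU N | dist1 h < twoδ}) ^ (Y.card * ((F.P p.K).L ^ (F.P p.K).d - 1)) :=
  have hg := sideχ_guards_of_three_side_le (F := F) p g hM1 h3
  measure_allSmall33_graph_le_pow_blockCombs p hK g s twoδ hg.1 hg.2 Y

end TopPair

end Summit.QuantumFields.YangMills.Theorems.BalabanUVNodesN11ChiPrimeAllSmallClassMeasure

end
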